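import Summits.CriticalPhenomena.SAWScalingLimit.Theses.SAWWeldingIdentification
import Summits.CriticalPhenomena.SAWScalingLimit.Theorems.SAWRenewalTightnessEventualTightOfBoundedVirginArc
import Summits.CriticalPhenomena.SAWScalingLimit.Theorems.SAWRenewalTightnessEventualTightOfItems

/-!
# EventualTightSplit_welding — crux-strategist s3 (stmt-CriticalPhenomena-1372), bet route `SAWWeldingIdentification`, AFTER the split (route rev 9)

The route-level split filed by this seat (2026-08-17T10:58Z, commit 616b35d018ac),

    EventualTight (stmt-1372) ⟸ VirginArcTraversalTightBounded (stmt-18042, X2c₁ᵇ) ∧ ConfinementPositivity (stmt-17587),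

re-derived BY NAME over the route's own (now existing) child decls from LANDED theorems only:
* `EventualTight_of_subs_welding` — the glue (`--glue-by` decl of p151500);
* `virginArcTraversalTightBounded_of_item` — the unbounded item stmt-17940 (`SAWExcursionCardy.VirginArcTraversalTight`) implies the new bounded
  child (so closing 17940 still closes everything), via `Theorems.virginArcTraversalTightBounded_of_finite`;
* `bulkShellTight_of_child` — the new child implies Renewal's bulk child stmt-17588.
A prover may land these verbatim as `Theorems/SAWWeldingIdentificationEventualTightSplit.lean --supports stmt-CriticalPhenomena-18042`.
-/

namespace Summit.CriticalPhenomena.SAWScalingLimit.Theses.SAWWeldingIdentification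

/-- The split glue, by name over this route's decls (= the `--glue-by` theorem p151500). [folklore] -/
theorem EventualTight_of_subs_welding :
    VirginArcTraversalTightBounded → ConfinementPositivity → EventualTight :=
  Summit.CriticalPhenomena.SAWScalingLimit.Theorems.eventualTight_of_virginArcTraversalTightBounded_of_confinementPositivity

/-- stmt-17940 (unbounded exteriors) ⟹ stmt-18042 (bounded exteriors). [folklore] -/
theorem virginArcTraversalTightBounded_of_item :
    SAWExcursionCardy.VirginArcTraversalTight → VirginArcTraversalTightBounded :=
  fun hX => Summit.CriticalPhenomena.SAWScalingLimit.Theorems.virginArcTraversalTightBounded_of_finite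
    (fun θ hθ => by
      obtain ⟨k, N₀, hN₀, hk⟩ := hX θ hθ
      exact ⟨k, N₀, hN₀, fun H Λ z₀ N u c u' c' _ hN hV hD hD' => hk H Λ z₀ N u c u' c' hN hV hD hD'⟩)

/-- stmt-18042 ⟹ stmt-17588 (`SAWRenewalTightness.BulkShellTight`). [folklore] -/
theorem bulkShellTight_of_child :
    VirginArcTraversalTightBounded → SAWRenewalTightness.BulkShellTight :=
  fun hX => Summit.CriticalPhenomena.SAWScalingLimit.Theorems.bulkShellTight_of_virginArcTraversalTightBounded hX

/-- sanity: the dedup'd child and the parent are definitionally the shared decls. -/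
example : ConfinementPositivity = SAWRenewalTightness.ConfinementPositivity := rfl
example : EventualTight = SAWRenewalTightness.EventualTight := rfl

end Summit.CriticalPhenomena.SAWScalingLimit.Theses.SAWWeldingIdentification
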